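/-
Copyright (c) 2026 the pub-hodgecm-mathlib formalisation cell (harness21).  Prover seat hodgecm-mathlib-LH7-p04 (g8), E3a pen: the `α`-side reading `hα` of ★ E3-CORE for the
localised test function `(Π_v F_v ∘ cl_v) · a′` (CENSUS-E3a v1.1 §3∕§4: «hα = ★ E2b + ★ (s1)», pen's own slice).
-/
import Literature.NumberTheory.Rogawski1990.ArchEPAssemblyDefiniteSwap     -- ★ (s1) p852258 (LH3-p03 (g8)): `sum_partnerPerms_chartOrbG_eq_card_mul_sum_integral_quotient_integral_group` (E2b with the `D`-integral INSIDE); brings ★ E2a∕E2b, (F′)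
import Literature.NumberTheory.Rogawski1990.ArchBouazizClassMultiplierG      -- ★ F4 (LH3-p04 (g7)): `orbFamGExt_classMul_bzClassMapG`, `bzClassMapG_slotPerm`; brings `orbFamGExt`, `bzClassG`, `bzClassMapG`
import HarnessLib

/-!
# EP assembly, the `α`-side reading: the definite closed form of `Σ_ρ Φ_α(ρ·c)` for the localised test function `(Π_{v∈D} F_v ∘ cl_v) · a′`

Topic `NumberTheory/Rogawski1990`; namespace `Literature.NumberTheory.Rogawski1990`.  THEOREMS ONLY (no definition, no instance, no notation, no named fact, no `sorry`); kernel lane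
`--supports stmt-HodgeConjecture-24833`.  Cell `pub/hodgecm-mathlib` (D-0151), crux H413; HCML «GO 500» road N8-INNER ROAD B «EP road» (owner LH2-plan (g1)), brick E3 «EP ASSEMBLY =
H-S4′», layer (L2) of E3a: the reading **`hα`** of ★ E3-CORE p852223 `stableSumG_eq_inv_pow_mul_of_readings` ∕ ★ (L1) p852251 `ballIdentity_of_readings`, for the `α`-side member of a
ball, `a″ := (Π_{v : p} F_v ∘ cl_v) · a′` (`F_v` the ball's smooth class factors, ★ E3b).  HONEST LABEL: count-neutral; HC_CM is proved only modulo the 7 printed citations (2 remaining: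
hLiu418 = stmt-HodgeConjecture-24832, h413 = stmt-HodgeConjecture-24833) until rung 0 closes.

THE READING.  On an admissible label `S′` avoiding the definite block `p` and at `c ∈ RegG S′`: every partner point `ρ·c` is regular (★ `slotPerm_mem_regG_iff`), the class multiplier
comes out FROZEN at `cl(c)` (★ F4 `orbFamGExt_classMul_bzClassMapG`, ★ `bzClassMapG_slotPerm`), the plain reading `orbFamGExt ∕ archRG` is `chartOrbG` (★ `orbFamGExt_of_mem_regG_of_admissible`,
★ `archRG_ne_zero_of_mem_regG`), and ★ (s1) `sum_partnerPerms_chartOrbG_eq_card_mul_sum_integral_quotient_integral_group` (= ★ E2b with the `D`-integral inside) reads the partner sum: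
**`Σ_{ρ} orbFamGExt L α ν′ a″ S′ (ρ·c) ∕ archRG S′ (ρ·c) = (Π_{v : p} F_v(cl_v c)) · 6^{#p} · Σ_{ρ₂ ∈ partnerPerms S′|_{¬p}} R_α ρ₂`** with
`R_α ρ₂ := (Π_{w′ : ¬p} t_{w′}(B′_{w′})) · ∫_{Π_{¬p}(U_{w′}⧸T′_{w′})} ∫_{Π_p U(α)_w} a′(e⁻¹((g γ_w((1 ⊔ ρ₂)·c) g⁻¹)_p, (ḃ γ_{w′}((1 ⊔ ρ₂)·c) ḃ⁻¹)_{¬p}))` — CORE's `hα` letter with `r v := F_v (bzClassMapG S′ c v)`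
(`head alphaReading_of_classMul`).  Context = ★ (s1)'s ((F′)∕(F1′) conventions: Borel quotient σ-algebras as section instances, product-measure convention `hν`, generic torus Haar `t`,
explicit subtype `Fintype` binders).

## References
* [Rogawski1990] J. D. Rogawski, *Automorphic Representations of Unitary Groups in Three Variables*, Ann. of Math. Stud. 123 (1990), §4.1 (4.1.1) p. 39; §8.2 p. 122; §14.2 (14.2.1) p. 232.
* [Shelstad1979] D. Shelstad, *Characters and inner forms of a quasi-split group over ℝ*, Compositio Math. 39 (1979), Lemma 4.2 p. 23.
* [Bouaziz1994IntegralesOrbitales] A. Bouaziz, *Intégrales orbitales sur les algèbres de Lie réductives*, Invent. Math. 115 (1994), §5.1 p. 588 (invariant multipliers).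
-/

set_option autoImplicit false

noncomputable section

open MeasureTheory MeasureTheory.Measure NumberField NumberField.InfinitePlace Matrix Complex Topology
open Literature.MeasureTheory.Group Literature.NumberTheory.Automorphic Literature.NumberTheory.Automorphic.UnitaryGroup Literature.NumberTheory.Automorphic.ArchCartan
open scoped MatrixGroups Matrix Classical ENNReal NNReal

namespace Literature.NumberTheory.Rogawski1990

section AlphaReading

variable (L : Type) [Field L] [NumberField L] [IsCMField L] (α : Fin 3 → L) (S' : Finset {w : InfinitePlace L // IsComplex w})
  [∀ w : {w : InfinitePlace L // IsComplex w}, MeasurableSpace ↥(archLocal L 3 (Matrix.diagonal α) w)]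
  [∀ w : {w : InfinitePlace L // IsComplex w}, BorelSpace ↥(archLocal L 3 (Matrix.diagonal α) w)]
  [∀ w : {w : InfinitePlace L // IsComplex w}, LocallyCompactSpace ↥(archLocal L 3 (Matrix.diagonal α) w)]
  [∀ w : {w : InfinitePlace L // IsComplex w}, SecondCountableTopology ↥(archLocal L 3 (Matrix.diagonal α) w)]
  [MeasurableSpace ↥(arch (↥(maximalRealSubfield L)) L (IsCMField.complexConj L) 3 (Matrix.diagonal α))]
  [BorelSpace ↥(arch (↥(maximalRealSubfield L)) L (IsCMField.complexConj L) 3 (Matrix.diagonal α))]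
  [∀ w : {w : InfinitePlace L // IsComplex w}, MeasurableSpace (↥(archLocal L 3 (Matrix.diagonal α) w) ⧸ chartTorusGLoc L α w S')]
  [∀ w : {w : InfinitePlace L // IsComplex w}, BorelSpace (↥(archLocal L 3 (Matrix.diagonal α) w) ⧸ chartTorusGLoc L α w S')]
  (ν'w : ∀ w : {w : InfinitePlace L // IsComplex w}, Measure ↥(archLocal L 3 (Matrix.diagonal α) w)) [∀ w, (ν'w w).IsHaarMeasure] [∀ w, (ν'w w).IsMulRightInvariant]
  (ν' : Measure ↥(arch (↥(maximalRealSubfield L)) L (IsCMField.complexConj L) 3 (Matrix.diagonal α))) [ν'.IsHaarMeasure] [ν'.IsMulRightInvariant]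
  (hν : ν' = (Measure.pi ν'w).map (archPiEquivCM 3 L (Matrix.diagonal α)).symm)
  (t : ∀ w : {w : InfinitePlace L // IsComplex w}, Measure ↥(chartTorusGLoc L α w S')) [∀ w, (t w).IsHaarMeasure] [∀ w, (t w).IsInvInvariant]
  (p : {w : InfinitePlace L // IsComplex w} → Prop) [DecidablePred p]
  [Fintype {w : {w : InfinitePlace L // IsComplex w} // p w}] [Fintype {w : {w : InfinitePlace L // IsComplex w} // ¬ p w}]

include hν in
/-- **THE `α`-SIDE READING `hα` OF THE EP ASSEMBLY, for the localised test function `a″ = (Π_{v : p} F_v ∘ cl_v) · a′`.**  On an admissible label `S′` (`hS′`) avoiding the definite block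
`p` (`hp`), at `c ∈ RegG S′`, for `a′` continuous with compact support and real class factors `F_v`:
`Σ_{ρ ∈ partnerPerms S′} orbFamGExt L α ν′ a″ S′ (ρ·c) ∕ archRG S′ (ρ·c) = (Π_v F_v (bzClassMapG S′ c v)) · 6^{#p} · Σ_{ρ₂} R_α ρ₂`, `R_α` = ★ (s1)'s summand VERBATIM (`D`-integral inside) —
the `hα` letter of ★ E3-CORE ∕ ★ (L1) with `r v := F_v (bzClassMapG S′ c v)`. [cite: Rogawski1990, §4.1 (4.1.1) p. 39; §8.2 p. 122] [cite: Shelstad1979, Lemma 4.2 p. 23]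
[cite: Bouaziz1994IntegralesOrbitales, §5.1 p. 588] -/
theorem alphaReading_of_classMul (hα : ∀ i, α i ≠ 0) (hherm : ∀ i, (IsCMField.complexConj L (α i) : L) = α i)
    (hS' : ∀ w, w ∈ S' → w ∈ splitChartPlaces L α) (hp : ∀ w, p w → w ∉ splitChartPlaces L α)
    {c : {w : InfinitePlace L // IsComplex w} → Fin 3 → ℝ} (hc : c ∈ ArchCartan.RegG S')
    {a' : ↥(arch (↥(maximalRealSubfield L)) L (IsCMField.complexConj L) 3 (Matrix.diagonal α)) → ℂ} (ha'c : Continuous a') (ha's : HasCompactSupport a')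
    (F : {w : {w : InfinitePlace L // IsComplex w} // p w} → ℂ × ℂ × ℂ → ℝ) :
    ∑ ρ ∈ partnerPerms S', orbFamGExt L α ν' (fun k => ((∏ v : {w : {w : InfinitePlace L // IsComplex w} // p w}, F v (bzClassG L α k v.1) : ℝ) : ℂ) * a' k) S' (slotPerm ρ c) /
        archRG S' (slotPerm ρ c) =
      (∏ v : {w : {w : InfinitePlace L // IsComplex w} // p w}, ((F v (bzClassMapG S' c v.1) : ℝ) : ℂ)) *
        (6 : ℂ) ^ Fintype.card {w : {w : InfinitePlace L // IsComplex w} // p w} *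
        ∑ ρ₂ ∈ partnerPerms (S'.subtype fun w => ¬ p w),
          (∏ w' : {w : {w : InfinitePlace L // IsComplex w} // ¬ p w}, ((t w'.1 (chartBoxImgGLoc L α w'.1 S')).toReal : ℂ)) *
            ∫ b : (∀ w' : {w : {w : InfinitePlace L // IsComplex w} // ¬ p w}, ↥(archLocal L 3 (Matrix.diagonal α) w'.1) ⧸ chartTorusGLoc L α w'.1 S'),
              (∫ g : (∀ w : {w : {w : InfinitePlace L // IsComplex w} // p w}, ↥(archLocal L 3 (Matrix.diagonal α) w.1)),
                a' ((archPiEquivCM 3 L (Matrix.diagonal α)).symm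
                  ((MeasurableEquiv.piEquivPiSubtypeProd (fun w : {w : InfinitePlace L // IsComplex w} => ↥(archLocal L 3 (Matrix.diagonal α) w)) p).symm
                    (fun w => g w * gprimeBlockAt L α w.1 S'
                        (slotPerm ((Equiv.piEquivPiSubtypeProd p (fun _ : {w : InfinitePlace L // IsComplex w} => Equiv.Perm (Fin 3))).symm (1, ρ₂)) c w.1) * (g w)⁻¹,
                      fun w' => descConj (gprimeBlockAt L α w'.1 S'
                          (slotPerm ((Equiv.piEquivPiSubtypeProd p (fun _ : {w : InfinitePlace L // IsComplex w} => Equiv.Perm (Fin 3))).symm (1, ρ₂)) c w'.1))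
                        (chartTorusGLoc L α w'.1 S')
                        (forall_mem_chartTorusGLoc_comm L α w'.1 S'
                          (slotPerm ((Equiv.piEquivPiSubtypeProd p (fun _ : {w : InfinitePlace L // IsComplex w} => Equiv.Perm (Fin 3))).symm (1, ρ₂)) c w'.1))
                        id (b w'))))
                ∂(Measure.pi fun w : {w : {w : InfinitePlace L // IsComplex w} // p w} => ν'w w.1))
              ∂(Measure.pi fun w' : {w : {w : InfinitePlace L // IsComplex w} // ¬ p w} =>
                  quotientMeasure (chartTorusGLoc L α w'.1 S') (t w'.1) (isClosed_chartTorusGLoc L α w'.1 S') (ν'w w'.1)) := by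
  -- the class multiplier as a class function on `W → ℂ³`
  obtain ⟨Fcl, hFcl⟩ : ∃ Fcl : ({w : InfinitePlace L // IsComplex w} → ℂ × ℂ × ℂ) → ℂ,
      ∀ Y, Fcl Y = ((∏ v : {w : {w : InfinitePlace L // IsComplex w} // p w}, F v (Y v.1) : ℝ) : ℂ) := ⟨_, fun _ => rfl⟩
  have hfun : (fun k : ↥(arch (↥(maximalRealSubfield L)) L (IsCMField.complexConj L) 3 (Matrix.diagonal α)) =>
      ((∏ v : {w : {w : InfinitePlace L // IsComplex w} // p w}, F v (bzClassG L α k v.1) : ℝ) : ℂ) * a' k) = fun k => Fcl (bzClassG L α k) * a' k := by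
    funext k; rw [hFcl]
  -- each partner point is regular: pull the frozen multiplier out of the plain reading
  have hterm : ∀ ρ ∈ partnerPerms S', orbFamGExt L α ν' (fun k => Fcl (bzClassG L α k) * a' k) S' (slotPerm ρ c) / archRG S' (slotPerm ρ c) =
      Fcl (bzClassMapG S' c) * chartOrbG L α ν' S' a' (slotPerm ρ c) := by
    intro ρ hρ
    have hρc : slotPerm ρ c ∈ RegG S' := (slotPerm_mem_regG_iff hρ c).2 hc
    rw [orbFamGExt_classMul_bzClassMapG L α ν' a' Fcl hS' hρc, bzClassMapG_slotPerm L hρ c, orbFamGExt_of_mem_regG_of_admissible L α ν' a' S' hS' hρc, mul_div_assoc,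
      mul_div_cancel_left₀ _ (archRG_ne_zero_of_mem_regG hρc)]
  rw [hfun, Finset.sum_congr rfl hterm, ← Finset.mul_sum,
    sum_partnerPerms_chartOrbG_eq_card_mul_sum_integral_quotient_integral_group L α S' ν'w ν' hν t p hα hherm hS' hp hc ha'c ha's, hFcl, Complex.ofReal_prod]
  ring

end AlphaReading

end Literature.NumberTheory.Rogawski1990
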